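import Summits.QuantumFields.YangMills.Theorems.BalabanUVNodesN21TorusBoxCombGaugePoincare
import Summits.QuantumFields.YangMills.Theorems.BalabanUVNodesK0Stub1FlatHessianLandauCoercivityAtRecord

/-!
# N21 (NE7c) · THE (1.7) ROW AT THE FLAT BACKGROUND IS A THEOREM: NODE O's Hessian operator of record `Δ_1 = hessOpAt η 1`
# (S1, dag-n07-w1) on the 𝔰𝔲(N)-valued bond field of a block chart vector, and the (M1) ENDs' (1.9) binder `h19` DISCHARGED at
# `U₀ = 1` for EVERY block off the comb of a non-wrapping box (file 12 of WIDTH-209 N21 piece 2)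

Width seat pub-ymgap-dag-n21-w3 (g6), node N21 = NE7c (NOT PRINTED, NOT proved), lane K3⁸ `SpineGivenEndpointR13SepCoPHV`
(stmt-QuantumFields-27366, `--kind proof --supports … --as helper`; K3⁷ 20544 = aside ∕ lineage).  Imports file 11
`…N21TorusBoxCombGaugePoincare` (THE TORUS (1.8); ★★ `ineq19_blockChartSU_of_ineq17_torus`) and k0-s1-w1 g2's
`…K0Stub1FlatHessianLandauCoercivityAtRecord` (★ `inner_hessOpAt_one_self_eq_sum_curl_normSq`:
`⟪X, Δ_1X⟫ = N⁻¹·Σ_{p : Plaq} Σ_{ii′}|(curl 1 X)(p)_{ii′}|²` on S1's carrier `Node00.TangentBondSU P j N`) — both BY NAME, nothing retyped.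

WHY.  Every file of this piece displays print's (1.7) row `⟨H₁B′, Δ₁(ζ₀)H₁B′⟩ ≥ γ₀‖∂B′‖² − O(1)(M⁶R_kε_k + e^{−R_k})‖B′‖²` as a
HYPOTHESIS about NODE O's operator `Δ₁(ζ₀)`.  At the FLAT background (`U₀ = 1`, `ζ₀ ≡ 1`) NODE O's operator IS typed: S1's
`hessOpAt η 1`, and k0-s1-w1 read its form as the torus curl energy.  Through pub-balaban's ORTHONORMAL chart coordinates
`coordSU : E_N ≃ₗᵢ 𝔰𝔲(N)` a block chart vector `v : BlockChartSU N b` IS an 𝔰𝔲(N)-valued bond field `X_v` (zero off `b`), and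
`N·⟪X_v, Δ_1 X_v⟫ = Σ_{p : Plaq} Σ_a |(curl 1 v̄)(p)_a|²` EXACTLY — the (1.7) row with `γ₀ = 1` and NO correction.  File 11's ★★
then gives (1.9): the flat Hessian of record is COERCIVE on block fields in the comb gauge of a non-wrapping box, constant
`(2d(100M)^{d+1})⁻¹` (after the factor `N` of S1's normalisation), with NO Landau ∕ averaging constraint — the block-chart
complement of k0-s1-w1's ★★ `hessOpAt_one_coercive_of_landau_of_bondAvgIter_eq_zero_T4` (whole torus, Landau ∩ `ker Q_k`).

WHAT (THEOREMS ONLY; 0 `def`, 0 `sorry`).  `X_v := WithLp.toLp 2 (bd ↦ coordSU (v bd) on b, 0 off b) : TangentBondSU P j N`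
(written out in each statement); `v̄` = the real-coordinate zero-extension of file 11.
* §1 [folklore] `coe_liftSU_apply` (the matrix of `X_v` at a bond is `genSU` of the `E_N`-valued zero-extension),
  `sum_normSq_genSU` (`Σ_{ii′}|genSU w_{ii′}|² = ‖w‖²`: `coordSU` is an isometry for the Hilbert–Schmidt form), `curl_coe_liftSU`
  (`curl 1` of the matrices of `X_v` = `genSU` of `curl 1` of the `E_N`-valued extension: `map_curl`), `curl_apply_eq`
  (its `a`-th coordinate is `curl 1 v̄ · a`), `normSq_liftSU` (`‖X_v‖² = Σ_{b′}‖v b′‖²`).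
* §2 ★ `mul_inner_hessOpAt_one_liftSU` : `N·⟪X_v, Δ_1 X_v⟫ = Σ_{p : Plaq} Σ_a (curl 1 v̄ p a)²`.
* §3 ★★ `ineq17_flat_liftSU` — THE (1.7) ROW AT THE FLAT BACKGROUND, PROVED: `Ineq17 (N·⟪X_v, Δ_1X_v⟫) (Σ_{p∈univ}Σ_a(curl 1 v̄ p a)²)
  (Σ‖v b′‖²) 1 0 M R_k ε_k` for every `v` (any `M`, `R_k`, `ε_k`: the correction is absent).
* §4 ★★★ `ineq19_blockChartSU_flat` — the ENDs' `h19` AT THE FLAT BACKGROUND, DISCHARGED: for every block `b` of box bonds off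
  the comb of a non-wrapping box with sides `≤ 100M` (`1 ≤ M`, `1 ≤ d`), `∀ v, Ineq19 (N·⟪X_v, Δ_1X_v⟫) (Σ‖v b′‖²) 1 d M`; ★★★
  `normSq_liftSU_le_mul_inner_hessOpAt_one` — the same as a coercivity line `‖X_v‖² ≤ 2d(100M)^{d+1}·N·⟪X_v, Δ_1 X_v⟫`;
  §4 `…_offComb`: the same at THE MAXIMAL BLOCK (all box bonds off the comb; `hbox`∕`hcomb` discharged by p639034).

HONEST FRAMING.  [folklore] linear algebra + tree theorems BY NAME (S1 `Node00.hessOpAt` ∕ `inner_tangentBondSU`, k0-s1-w1's ★,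
pub-balaban's `coordSU`∕`genSU`, file 11); FLAT background ONLY (`U₀ = 1`): the (1.7) row for Bałaban's `Δ₁(ζ₀)` at a
non-trivial small background — NODE O's term object — is NOT touched and stays displayed in files 6–11; the identification of
an END's quadratic member `Qf` with `N·⟪X_v, Δ_1X_v⟫` (the located reading of `⟨H_{1,k}B′, Δ₁H_{1,k}B′⟩` at `U₀ = 1`) is LOCATED
typing, NOT asserted; WHICH box ∕ block is dag-n21-w2 ∕ dag-n21-d's; nothing of Bałaban's asserted; (M1) ∕ NE7c NOT PRINTED ∕
NOT proved; N21 NOT discharged; K3⁸ NOT claimed; `stub_prop8StepCoP13` ∕ K0⁷ untouched; counts unmoved (typed 28∕28 ·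
discharged 5∕27); count-neutral; one finite 𝕋⁴ at fixed ε — the Yang–Mills mass gap (Clay) is NOT proved by any of this: R4
closes the conditional finite-𝕋⁴ rung `BalabanLadder.UV` only; nothing continuum ∕ ℝ⁴ ∕ OS.
-/

set_option autoImplicit false

noncomputable section

open Set Function Finset Metric
open scoped InnerProductSpace RealInnerProductSpace

namespace Summit.QuantumFields.YangMills.Theorems.N21ChartExponentCoercivityFlat

open Literature.MathematicalPhysics.QuantumFieldTheory.Balaban1983to89
open Literature.MathematicalPhysics.QuantumFieldTheory.Balaban1983to89.Node00 (TangentBondSU hessOpAt SU)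
open Literature.MathematicalPhysics.QuantumFieldTheory.Balaban1983to89.B16Sect1Wilson (Ineq17 Ineq18 Ineq19)
open Literature.MathematicalPhysics.QuantumFieldTheory.Balaban1983to89.T4AxialGaugeSmallField (boxBonds boxPlaqs)
open Literature.MathematicalPhysics.QuantumFieldTheory.Balaban1983to89.T4AxialGaugeFixing (combBonds)
open Literature.MathematicalPhysics.QuantumFieldTheory.Balaban1983to89.LatticeFieldCalculus (curl)
open T4AdjointCovarianceUnitary (lieSU)
open Summit.QuantumFields.BalabanUV.T4Continuum.ShellMeasureExpChartSUN
  (BlockChartSU ChartSU dimSU coordSU genSU genSU_zero norm_genSU)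
open Summit.QuantumFields.YangMills.Theorems.N21LowCentreEndAtSUNBlockChart (sum_sq_flatten)
open Summit.QuantumFields.YangMills.Theorems.K0Stub1FlatHessianLandauCoercivity
  (map_curl inner_hessOpAt_one_self_eq_sum_curl_normSq)
open Summit.QuantumFields.YangMills.Theorems.N21TorusBoxCombGaugePoincare (ineq19_blockChartSU_of_ineq17_torus)

variable {P : Params} {j : ℕ} {N : ℕ}

/-! ## §1  The 𝔰𝔲(N)-valued bond field of a block chart vector: matrices, curl, norms -/

section Lift

variable {b : Finset (PBond P j)}

/-- the matrix of `X_v` at a bond is the generator `genSU` of the `E_N`-valued zero-extension of `v` (`genSU 0 = 0` off `b`).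
[folklore] -/
theorem coe_liftSU_apply (v : BlockChartSU N b) (bd : PBond P j) :
    (((WithLp.toLp 2 fun bd' : PBond P j =>
        if h : bd' ∈ b then coordSU (v ⟨bd', h⟩) else (0 : lieSU (Fin N))) : TangentBondSU P j N) bd :
        Matrix (Fin N) (Fin N) ℂ) =
      genSU (if h : bd ∈ b then v ⟨bd, h⟩ else (0 : ChartSU N)) := by
  show (((if h : bd ∈ b then coordSU (v ⟨bd, h⟩) else (0 : lieSU (Fin N))) : lieSU (Fin N)) :
      Matrix (Fin N) (Fin N) ℂ) = _
  by_cases h : bd ∈ b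
  · rw [dif_pos h, dif_pos h]; rfl
  · rw [dif_neg h, dif_neg h, genSU_zero, Submodule.coe_zero]

/-- `coordSU` IS A HILBERT–SCHMIDT ISOMETRY, entrywise: `Σ_{i,i′} |(genSU w)_{ii′}|² = ‖w‖²` (`MatrixNorms.sum_norm_sq_eq_re_trace`,
the Frobenius form of `lieSU`, `norm_genSU`). [cite: Balaban1985Averaging, (17) p.21] [folklore] -/
theorem sum_normSq_genSU (w : ChartSU N) : ∑ i, ∑ i', ‖genSU w i i'‖ ^ 2 = ‖w‖ ^ 2 := by
  rw [MatrixNorms.sum_norm_sq_eq_re_trace, ← norm_genSU w, ← real_inner_self_eq_norm_sq]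
  rfl

/-- THE CURL OF THE LIFT: `curl 1` of the matrices of `X_v` is `genSU` of `curl 1` of the `E_N`-valued zero-extension (the
coefficients map `E_N → 𝔰𝔲(N) ⊂ M_N(ℂ)` is real-linear: k0-s1-w1's `map_curl`). [cite: Balaban1984PropagatorsI, (1.2) p.18] [folklore] -/
theorem curl_coe_liftSU (v : BlockChartSU N b) (p : Plaq P j) :
    curl 1 (fun bd : PBond P j =>
        ((((WithLp.toLp 2 fun bd' : PBond P j =>
            if h : bd' ∈ b then coordSU (v ⟨bd', h⟩) else (0 : lieSU (Fin N))) : TangentBondSU P j N) bd :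
            lieSU (Fin N)) : Matrix (Fin N) (Fin N) ℂ)) p =
      genSU (curl 1 (fun bd : PBond P j => if h : bd ∈ b then v ⟨bd, h⟩ else (0 : ChartSU N)) p) := by
  have hφ : ∀ w : ChartSU N,
      ((lieSU (Fin N)).subtype ∘ₗ (coordSU (N := N)).toLinearEquiv.toLinearMap) w = genSU w := fun w => rfl
  rw [← hφ, map_curl]
  refine congrArg (fun A : VecField P j (Matrix (Fin N) (Fin N) ℂ) => curl 1 A p) (funext fun bd => ?_)
  rw [hφ, coe_liftSU_apply]

/-- the `a`-th coordinate of `curl 1` of the `E_N`-valued zero-extension is `curl 1` of file 11's real-coordinate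
zero-extension `v̄` at `a`. [cite: Balaban1984PropagatorsI, (1.2) p.18] [folklore] -/
theorem curl_apply_eq (v : BlockChartSU N b) (p : Plaq P j) (a : Fin (dimSU N)) :
    curl 1 (fun bd : PBond P j => if h : bd ∈ b then v ⟨bd, h⟩ else (0 : ChartSU N)) p a =
      curl 1 (fun (bd : PBond P j) (a' : Fin (dimSU N)) => if h : bd ∈ b then v ⟨bd, h⟩ a' else (0 : ℝ)) p a := by
  have key : ∀ bd : PBond P j, (WithLp.ofLp (if h : bd ∈ b then v ⟨bd, h⟩ else (0 : ChartSU N))) a =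
      if h : bd ∈ b then v ⟨bd, h⟩ a else (0 : ℝ) := fun bd => by
    split_ifs with h
    · rfl
    · simp
  simp only [LatticeFieldCalculus.curl, one_smul, WithLp.ofLp_add, WithLp.ofLp_sub, Pi.add_apply, Pi.sub_apply, key]

/-- THE NORM OF THE LIFT: `‖X_v‖² = Σ_{b′} ‖v b′‖²` (`coordSU` is an isometry; zero off `b`). [folklore] -/
theorem normSq_liftSU (v : BlockChartSU N b) :
    ‖((WithLp.toLp 2 fun bd' : PBond P j =>
          if h : bd' ∈ b then coordSU (v ⟨bd', h⟩) else (0 : lieSU (Fin N))) : TangentBondSU P j N)‖ ^ 2 = ∑ i, ‖v i‖ ^ 2 := by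
  rw [PiLp.norm_sq_eq_of_L2]
  have hg : ∀ bd : PBond P j, ‖(((WithLp.toLp 2 fun bd' : PBond P j =>
          if h : bd' ∈ b then coordSU (v ⟨bd', h⟩) else (0 : lieSU (Fin N))) : TangentBondSU P j N)) bd‖ ^ 2 = if h : bd ∈ b then ‖v ⟨bd, h⟩‖ ^ 2 else 0 := by
    intro bd
    show ‖(if h : bd ∈ b then coordSU (v ⟨bd, h⟩) else (0 : lieSU (Fin N)))‖ ^ 2 = _
    split_ifs with h
    · rw [norm_genSU]
    · simp
  rw [Finset.sum_congr rfl fun bd _ => hg bd, ← Finset.sum_subset (Finset.subset_univ b)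
      (fun bd _ hbd => by rw [dif_neg hbd]), ← Finset.sum_coe_sort b]
  exact Finset.sum_congr rfl fun i _ => by rw [dif_pos i.2]

end Lift

/-! ## §2  ★ NODE O's flat Hessian of record on the lift = the torus curl energy of the real-coordinate zero-extension -/

section FlatForm

variable [NeZero N] {b : Finset (PBond P j)}

/-- ★ **`N·⟪X_v, Δ_1 X_v⟫ = Σ_{p : Plaq} Σ_a |(curl 1 v̄)(p)_a|²`**: S1's flat Hessian operator of record `hessOpAt η 1` on the
𝔰𝔲(N)-valued lift of a block chart vector is the TORUS CURL ENERGY of its real-coordinate zero-extension — k0-s1-w1's ★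
`inner_hessOpAt_one_self_eq_sum_curl_normSq` + §1. [cite: Balaban1985BackgroundPropagators, (3.10) p.392; Balaban1984PropagatorsI, (1.2) p.18] [folklore] -/
theorem mul_inner_hessOpAt_one_liftSU {η : ℝ} (hη : η ≠ 0) (v : BlockChartSU N b) :
    (N : ℝ) * ⟪((WithLp.toLp 2 fun bd' : PBond P j =>
          if h : bd' ∈ b then coordSU (v ⟨bd', h⟩) else (0 : lieSU (Fin N))) : TangentBondSU P j N),
        hessOpAt η (1 : GaugeField P j (SU N)) ((WithLp.toLp 2 fun bd' : PBond P j =>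
          if h : bd' ∈ b then coordSU (v ⟨bd', h⟩) else (0 : lieSU (Fin N))) : TangentBondSU P j N)⟫_ℝ =
      ∑ p : Plaq P j, ∑ a : Fin (dimSU N), curl 1 (fun (bd : PBond P j) (a' : Fin (dimSU N)) => if h : bd ∈ b then v ⟨bd, h⟩ a' else (0 : ℝ)) p a ^ 2 := by
  rw [inner_hessOpAt_one_self_eq_sum_curl_normSq hη, ← mul_assoc,
    mul_inv_cancel₀ (Nat.cast_ne_zero.2 (NeZero.ne N)), one_mul]
  refine Finset.sum_congr rfl fun p _ => ?_
  rw [curl_coe_liftSU, sum_normSq_genSU, EuclideanSpace.real_norm_sq_eq]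
  exact Finset.sum_congr rfl fun a _ => by rw [curl_apply_eq]

/-- ★★ **THE (1.7) ROW AT THE FLAT BACKGROUND, PROVED**: for every block chart vector `v`, print's (1.7) with `γ₀ = 1` and NO
correction term holds — with EQUALITY — for the quadratic member `N·⟪X_v, Δ_1 X_v⟫` against the torus curl energy of `v̄` over
ALL plaquettes and `Σ_{b′}‖v b′‖²` (`M`, `R_k`, `ε_k` arbitrary: the `O(1)`-constant is `0`). [cite: Balaban1989LargeFieldII, (1.7) p.358] [folklore] -/
theorem ineq17_flat_liftSU {η : ℝ} (hη : η ≠ 0) (M Rk εk : ℝ) (v : BlockChartSU N b) :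
    Ineq17 ((N : ℝ) * ⟪((WithLp.toLp 2 fun bd' : PBond P j =>
          if h : bd' ∈ b then coordSU (v ⟨bd', h⟩) else (0 : lieSU (Fin N))) : TangentBondSU P j N),
        hessOpAt η (1 : GaugeField P j (SU N)) ((WithLp.toLp 2 fun bd' : PBond P j =>
          if h : bd' ∈ b then coordSU (v ⟨bd', h⟩) else (0 : lieSU (Fin N))) : TangentBondSU P j N)⟫_ℝ)
      (∑ p ∈ (Finset.univ : Finset (Plaq P j)), ∑ a : Fin (dimSU N), curl 1 (fun (bd : PBond P j) (a' : Fin (dimSU N)) => if h : bd ∈ b then v ⟨bd, h⟩ a' else (0 : ℝ)) p a ^ 2)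
      (∑ i, ‖v i‖ ^ 2) 1 0 M Rk εk := by
  unfold Ineq17
  rw [mul_inner_hessOpAt_one_liftSU hη, one_mul, zero_mul, zero_mul, sub_zero]

end FlatForm

/-! ## §3  ★★★ The ENDs' (1.9) binder AT THE FLAT BACKGROUND, DISCHARGED: the flat Hessian of record is coercive on block fields
in the comb gauge of a non-wrapping box -/

section FlatCoercivity

variable [NeZero N] {lo hi : Fin P.d → ℤ}

/-- ★★★ **`h19` AT THE FLAT BACKGROUND IS A THEOREM.**  For every block `b` of box bonds off the comb of a NON-WRAPPING box `[lo, hi]`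
with sides `hi_κ + 1 − lo_κ ≤ 100M` (`1 ≤ M`, `1 ≤ d`) and every `v : BlockChartSU N b`:
`Ineq19 (N·⟪X_v, Δ_1 X_v⟫) (Σ_{b′}‖v b′‖²) 1 d M`, i.e. `Σ‖v b′‖² ∕ (2d(100M)^{d+1}) ≤ N·⟪X_v, Δ_1X_v⟫` — file 11's ★★
`ineq19_blockChartSU_of_ineq17_torus` (THE TORUS (1.8)) fed by §2's PROVED flat (1.7) row over `S_p = univ`.
[cite: Balaban1989LargeFieldII, (1.7)–(1.9) p.358] [folklore] -/
theorem ineq19_blockChartSU_flat (hN : ∀ κ, hi κ - lo κ < P.sitesPerDir j) (M : ℕ) (hd : 1 ≤ P.d)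
    (hsides : ∀ κ, hi κ + 1 - lo κ ≤ 100 * M) (hM : 1 ≤ M) (b : Finset (PBond P j))
    (hbox : ∀ i ∈ b, i ∈ (boxBonds lo hi : Set (PBond P j)))
    (hcomb : ∀ i ∈ b, i ∉ (combBonds lo hi : Finset (PBond P j))) {η : ℝ} (hη : η ≠ 0) :
    ∀ v : BlockChartSU N b, Ineq19 ((N : ℝ) * ⟪((WithLp.toLp 2 fun bd' : PBond P j =>
          if h : bd' ∈ b then coordSU (v ⟨bd', h⟩) else (0 : lieSU (Fin N))) : TangentBondSU P j N),
        hessOpAt η (1 : GaugeField P j (SU N)) ((WithLp.toLp 2 fun bd' : PBond P j =>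
          if h : bd' ∈ b then coordSU (v ⟨bd', h⟩) else (0 : lieSU (Fin N))) : TangentBondSU P j N)⟫_ℝ)
      (∑ i, ‖v i‖ ^ 2) 1 P.d M := by
  have hSp : (boxPlaqs lo hi : Set (Plaq P j)) ⊆ ↑(Finset.univ : Finset (Plaq P j)) := by
    rw [Finset.coe_univ]; exact Set.subset_univ _
  have hsmall : (0 : ℝ) * ((M : ℝ) ^ 6 * (0 : ℝ) * 0 + Real.exp (-0)) ≤ 1 / (2 * P.d * (100 * (M : ℝ)) ^ (P.d + 1)) := by
    rw [zero_mul]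
    have hd0 : (0 : ℝ) < P.d := by exact_mod_cast hd
    have hM0 : (0 : ℝ) < M := by exact_mod_cast hM
    positivity
  exact ineq19_blockChartSU_of_ineq17_torus hN M hd hsides hM b hbox hcomb _ zero_le_one Finset.univ hSp
    (fun v => ineq17_flat_liftSU hη (M : ℝ) 0 0 v) hsmall

/-- ★★★ **COERCIVITY OF THE FLAT HESSIAN OF RECORD ON BLOCK FIELDS IN THE COMB GAUGE**:
`‖X_v‖² ≤ 2d(100M)^{d+1} · N · ⟪X_v, Δ_1 X_v⟫` for every block `b` off the comb of a non-wrapping box with sides `≤ 100M` and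
every `v` — NO Landau condition, NO averaging constraint (the block-chart complement of k0-s1-w1's
`hessOpAt_one_coercive_of_landau_of_bondAvgIter_eq_zero_T4`). [cite: Balaban1989LargeFieldII, (1.9) p.358; Balaban1984PropagatorsI, Prop. 1.1 (1.90) p.33] [folklore] -/
theorem normSq_liftSU_le_mul_inner_hessOpAt_one (hN : ∀ κ, hi κ - lo κ < P.sitesPerDir j) (M : ℕ) (hd : 1 ≤ P.d)
    (hsides : ∀ κ, hi κ + 1 - lo κ ≤ 100 * M) (hM : 1 ≤ M) (b : Finset (PBond P j))
    (hbox : ∀ i ∈ b, i ∈ (boxBonds lo hi : Set (PBond P j)))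
    (hcomb : ∀ i ∈ b, i ∉ (combBonds lo hi : Finset (PBond P j))) {η : ℝ} (hη : η ≠ 0) (v : BlockChartSU N b) :
    ‖((WithLp.toLp 2 fun bd' : PBond P j =>
          if h : bd' ∈ b then coordSU (v ⟨bd', h⟩) else (0 : lieSU (Fin N))) : TangentBondSU P j N)‖ ^ 2 ≤
      2 * P.d * (100 * (M : ℝ)) ^ (P.d + 1) * ((N : ℝ) * ⟪((WithLp.toLp 2 fun bd' : PBond P j =>
          if h : bd' ∈ b then coordSU (v ⟨bd', h⟩) else (0 : lieSU (Fin N))) : TangentBondSU P j N),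
        hessOpAt η (1 : GaugeField P j (SU N)) ((WithLp.toLp 2 fun bd' : PBond P j =>
          if h : bd' ∈ b then coordSU (v ⟨bd', h⟩) else (0 : lieSU (Fin N))) : TangentBondSU P j N)⟫_ℝ) := by
  have h := ineq19_blockChartSU_flat hN M hd hsides hM b hbox hcomb hη v
  unfold Ineq19 at h
  rw [normSq_liftSU]
  have hK : (0 : ℝ) < 2 * P.d * (100 * (M : ℝ)) ^ (P.d + 1) := by
    have hd0 : (0 : ℝ) < P.d := by exact_mod_cast hd
    have hM0 : (0 : ℝ) < M := by exact_mod_cast hM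
    positivity
  rw [div_mul_eq_mul_div, one_mul, div_le_iff₀ hK] at h
  linarith [h]

end FlatCoercivity

/-! ## §4  The maximal block: ALL box bonds off the comb (p639034's `castBond '' (innerBonds ∖ treeBonds) = boxBonds ∖ combSet`) -/

section MaximalBlock

variable [NeZero N] {lo hi : Fin P.d → ℤ}

open Literature.MathematicalPhysics.QuantumFieldTheory.Balaban1983to89.B16Eq18Proof (innerBonds treeBonds)
open Literature.MathematicalPhysics.QuantumFieldTheory.Balaban1983to89.T4AxialGaugeSmallField (castSite)
open Summit.QuantumFields.YangMills.Theorems.N21AxialCombDictionary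
  (mem_boxBonds_of_mem_image_offTree not_mem_combBonds_of_mem_image_offTree)

/-- ★★★ at THE MAXIMAL BLOCK — every box bond off the comb (junction №5's letters `hbox` ∕ `hcomb` DISCHARGED by p639034's
`mem_boxBonds_of_mem_image_offTree` ∕ `not_mem_combBonds_of_mem_image_offTree`): on a non-wrapping box with sides `≤ 100M` the
flat Hessian of record is coercive on EVERY 𝔰𝔲(N)-valued bond field supported in the box in the axial comb gauge,
`‖X_v‖² ≤ 2d(100M)^{d+1}·N·⟪X_v, Δ_1 X_v⟫`. [cite: Balaban1989LargeFieldII, (1.9) p.358] [folklore] -/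
theorem normSq_liftSU_le_mul_inner_hessOpAt_one_offComb (hN : ∀ κ, hi κ - lo κ < P.sitesPerDir j) (M : ℕ) (hd : 1 ≤ P.d)
    (hsides : ∀ κ, hi κ + 1 - lo κ ≤ 100 * M) (hM : 1 ≤ M) {η : ℝ} (hη : η ≠ 0)
    (v : BlockChartSU N ((innerBonds (fun κ => (hi κ + 1 - lo κ).toNat) lo \ treeBonds (fun κ => (hi κ + 1 - lo κ).toNat) lo).image
        fun bd : (Fin P.d → ℤ) × Fin P.d => (⟨castSite bd.1, bd.2⟩ : PBond P j))) :
    ‖((WithLp.toLp 2 fun bd' : PBond P j =>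
          if h : bd' ∈ ((innerBonds (fun κ => (hi κ + 1 - lo κ).toNat) lo \ treeBonds (fun κ => (hi κ + 1 - lo κ).toNat) lo).image
        fun bd : (Fin P.d → ℤ) × Fin P.d => (⟨castSite bd.1, bd.2⟩ : PBond P j)) then coordSU (v ⟨bd', h⟩) else (0 : lieSU (Fin N))) :
          TangentBondSU P j N)‖ ^ 2 ≤
      2 * P.d * (100 * (M : ℝ)) ^ (P.d + 1) * ((N : ℝ) * ⟪((WithLp.toLp 2 fun bd' : PBond P j =>
          if h : bd' ∈ ((innerBonds (fun κ => (hi κ + 1 - lo κ).toNat) lo \ treeBonds (fun κ => (hi κ + 1 - lo κ).toNat) lo).image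
        fun bd : (Fin P.d → ℤ) × Fin P.d => (⟨castSite bd.1, bd.2⟩ : PBond P j)) then coordSU (v ⟨bd', h⟩) else (0 : lieSU (Fin N))) :
          TangentBondSU P j N),
        hessOpAt η (1 : GaugeField P j (SU N)) ((WithLp.toLp 2 fun bd' : PBond P j =>
          if h : bd' ∈ ((innerBonds (fun κ => (hi κ + 1 - lo κ).toNat) lo \ treeBonds (fun κ => (hi κ + 1 - lo κ).toNat) lo).image
        fun bd : (Fin P.d → ℤ) × Fin P.d => (⟨castSite bd.1, bd.2⟩ : PBond P j)) then coordSU (v ⟨bd', h⟩) else (0 : lieSU (Fin N))) :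
          TangentBondSU P j N)⟫_ℝ) :=
  normSq_liftSU_le_mul_inner_hessOpAt_one hN M hd hsides hM _ (fun _ hi' => mem_boxBonds_of_mem_image_offTree hi')
    (fun _ hi' => not_mem_combBonds_of_mem_image_offTree hN hi') hη v

end MaximalBlock


end Summit.QuantumFields.YangMills.Theorems.N21ChartExponentCoercivityFlat

end
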